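import Literature.Analysis.FunctionSpaces.LiebWuDoubleOccupancyEnclosure
import HarnessLib

/-!
# Kernel-checked enclosure of the half-filled Lieb–Wu energy at `U = 4t`, ON the circle of convergence of
# Takahashi's series

Family `hubbard`; STEP-0 rung (i) of the `hubbard-alg` programme ("1D Hubbard vs Lieb–Wu to 1e-3") at the grid point
`(U, n) = (4, 1)`. The tree constant `e_LW(4) = liebWuEnergy 4 = -4 ∫₀^∞ J₀J₁ dω/(ω(1 + e^{2ω}))` (Lieb–Wu 1968
eq. (20); cell value `-0.57372936789844927…`, REFVALS `M1/TL/n1/U4/e0/LiebWu-CERT`) gets a TWO-SIDED bound BY NAME: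

* `liebWuEnergy_four_mem_Icc : liebWuEnergy 4 ∈ [-0.573729411, -0.573729316]` (width `9.5·10⁻⁸`).

The large-`u` series of Takahashi 1971 / Oitmaa–Hamer–Zheng 2006 (8.5)–(8.7) proved in
`LiebWuEnergyStrongCouplingSeries` (`hasSum_liebWuEnergy_strongCoupling`, `U > 4`) has radius `u = U/4t = 1`: at
`U = 4` it still converges, but only like `Σ 1/m²`, and the tree's remainder bound degenerates. The way around it
(elementary; not in the printed sources, which evaluate `e(4)` by quadrature): in the proof of (8.5),
`e(U) = -4 ln 2/U - 4 Σ_{n ≥ 0} (-1)^n I_{(n+1)U/2}`, `I_c = ∫₀^∞ e^{-cω} g(ω) dω`, `g = J₀J₁/ω - 1/2`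
(`liebWuEnergy_eq_sub_integral`, `hasSum_integral_besselJ01Sub_fermi`), only the `n = 0` term `I₂` sits ON the
circle `c = 2` of the Laplace expansion `I_c = Σ_m (-1)^{m+1} γ_{m+1}/c^{2m+3}` (`hasSum_integral_exp_neg_mul_besselJ01Sub`,
`c > 2`); all other `c = 2(n+1) ≥ 4` are interior. So

1. `liebWuEnergy_four_eq`: `e(4) = -ln 2 - 4 I₂ - 4 R`, `R = Σ_m (-1)^m a_m (1 - η(2m+3))`, `a_m = γ_{m+1}/2^{2m+3}`
   (Fubini over the interior terms exactly as for `U > 4`; `R` converges geometrically, `|term_m| ≤ 2^{-(2m+5)}`);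
2. the Laplace expansion still holds AT `c = 2` (`hasSum_integral_exp_neg_two_mul_besselJ01Sub`): the recurrence
   `γ_{m+1} (m+2)² = γ_m (2m+1)(2m+3)` (`besselJ01Moment_succ_mul_sq`) gives the sharp growth
   `γ_m ≤ 4^m/((m+1)(m+2))` (`besselJ01Moment_le_four_pow_div`; true size `4^m/(π m²)`), so `Σ_m ∫|term_m| < ∞` at `c = 2`;
3. `I₂ = -Σ_m (-1)^m a_m` is a slowly convergent ALTERNATING series whose terms `a_m = (3/64)(3/2)_m(5/2)_m/((3)_m)²` have
   decreasing first, second and third differences (`antitone_boundaryTerm_sub…₃`: the numerators are polynomials with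
   non-negative coefficients), so the classical convexity refinement of Leibniz's bound encloses the tail after `40`
   terms to fourth order, width `Δ³a₄₀/8 = 3·10⁻⁹` (`integral_exp_neg_two_mul_besselJ01Sub_mem_Icc`, using the tree's
   `γ_1, …, γ_44`);
4. `η(3)` is re-enclosed the same way to `1.4·10⁻⁸` from the tree's 100 terms (`dirichletEta_three_mem_Icc`), `η(5..25)`
   are the tree's, `ln 2` is Mathlib's `log_two_near_10`; everything else is rational arithmetic (`norm_num`, `linarith`).

The result agrees with the cell's value; it is not a number of record of the programme (those are the certified CHAIN
brackets), but it lets the Venture predicate `M1ReproducesLiebWu 4 lo hi` be proved outright for the M1 `(4, 1)` cell of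
record (`HubbardAlg/M1ReproducesLiebWuU4.lean`), whose MPS upper edge sits only `1.1·10⁻⁶` above `e_LW(4)`.
Zero named facts. HONEST FRAMING: first certified bounds; not a superconductivity verdict; every number certified or
labelled float.

## References

* J. Oitmaa, C. Hamer, W. Zheng, *Series Expansion Methods*, CUP 2006, §8.2.1 eqs. (8.5)–(8.7), PDF p. 156–157
  (key `OitmaaHamerZheng2006`).
* E. H. Lieb, F. Y. Wu, PRL 20 (1968) 1445, eq. (20) (key `LiebWuPRL1968`).
* DLMF 25.2.3 (key `DLMF`).
-/

noncomputable section

open Filter Set Real Nat MeasureTheory Finset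
open scoped Topology

namespace Literature.Analysis.FunctionSpaces

open Literature.Analysis.SpecialFunctions (summable_one_div_succ_pow)

/-! ## Alternating series with convex terms: the classical half-term bounds -/

section Alternating

variable {f : ℕ → ℝ}

/-- For an antitone summable `f` (hence `f ≥ 0`, `f → 0`): `0 ≤ Σ (-1)^i f i ≤ f 0`. [folklore] -/
private theorem tsum_alternating_nonneg_le (hfa : Antitone f) (hfs : Summable f) :
    0 ≤ ∑' i, (-1) ^ i * f i ∧ ∑' i, (-1) ^ i * f i ≤ f 0 := by
  have h0 := alternating_series_error_bound f hfa hfs 0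
  have h1 := alternating_series_error_bound f hfa hfs 1
  simp only [Finset.sum_range_zero, sub_zero] at h0
  simp only [Finset.sum_range_one, pow_zero, one_mul] at h1
  have h01 : f 1 ≤ f 0 := hfa (by norm_num)
  rw [abs_le] at h0 h1
  constructor <;> linarith [h0.2, h1.1]

/-- `Σ (-1)^i (f i - f (i+1)) = 2 Σ (-1)^i f i - f 0` for summable `f`. [folklore] -/
private theorem tsum_alternating_sub_succ (hfs : Summable f) :
    ∑' i, (-1) ^ i * (f i - f (i + 1)) = 2 * ∑' i, (-1) ^ i * f i - f 0 := by
  have h1 : Summable fun i => (-1 : ℝ) ^ i * f i := hfs.alternating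
  have h2 : Summable fun i => (-1 : ℝ) ^ i * f (i + 1) := ((summable_nat_add_iff 1).mpr hfs).alternating
  have hshift : ∑' i, (-1 : ℝ) ^ i * f i = (-1 : ℝ) ^ 0 * f 0 + ∑' i, (-1 : ℝ) ^ (i + 1) * f (i + 1) :=
    h1.tsum_eq_zero_add
  have e : ∑' i, (-1 : ℝ) ^ (i + 1) * f (i + 1) = -∑' i, (-1 : ℝ) ^ i * f (i + 1) := by
    rw [← tsum_neg]; congr 1; funext i; rw [pow_succ]; ring
  have e2 : (fun i => (-1 : ℝ) ^ i * (f i - f (i + 1))) = fun i => (-1) ^ i * f i - (-1) ^ i * f (i + 1) := by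
    funext i; ring
  rw [e2, h1.tsum_sub h2]
  rw [e, pow_zero, one_mul] at hshift
  linarith

/-- **Convex alternating series**: if the differences `f i - f (i+1)` are antitone and `f` is summable, then
`f 0/2 ≤ Σ (-1)^i f i ≤ f 0 - f 1/2` (the sum lies within half a difference of "half the first term"). [folklore] -/
private theorem tsum_alternating_bounds_of_convex (hfs : Summable f) (hc : Antitone fun i => f i - f (i + 1)) :
    f 0 / 2 ≤ ∑' i, (-1) ^ i * f i ∧ ∑' i, (-1) ^ i * f i ≤ f 0 - f 1 / 2 := by
  have hgs : Summable fun i => f i - f (i + 1) := hfs.sub ((summable_nat_add_iff 1).mpr hfs)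
  have h := tsum_alternating_nonneg_le hc hgs
  rw [tsum_alternating_sub_succ hfs] at h
  constructor <;> linarith [h.1, h.2]

/-- **Third order**: if moreover the second differences are antitone, then
`f 0/2 + (f 0 - f 1)/4 ≤ Σ (-1)^i f i ≤ f 0/2 + (f 0 - f 1)/2 - (f 1 - f 2)/4`. [folklore] -/
private theorem tsum_alternating_bounds_of_convex₂ (hfs : Summable f)
    (hc2 : Antitone fun i => (f i - f (i + 1)) - (f (i + 1) - f (i + 2))) :
    f 0 / 2 + (f 0 - f 1) / 4 ≤ ∑' i, (-1) ^ i * f i ∧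
      ∑' i, (-1) ^ i * f i ≤ f 0 / 2 + (f 0 - f 1) / 2 - (f 1 - f 2) / 4 := by
  have hgs : Summable fun i => f i - f (i + 1) := hfs.sub ((summable_nat_add_iff 1).mpr hfs)
  have h := tsum_alternating_bounds_of_convex hgs hc2
  rw [tsum_alternating_sub_succ hfs] at h
  constructor <;> linarith [h.1, h.2]

/-- **Fourth order**: if the third differences are antitone, then with `g_i = f i - f (i+1)`, `h_i = g_i - g_{i+1}`:
`f 0/2 + g₀/4 + h₀/8 ≤ Σ (-1)^i f i ≤ f 0/2 + g₀/4 + h₀/4 - h₁/8`. [folklore] -/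
private theorem tsum_alternating_bounds_of_convex₃ (hfs : Summable f)
    (hc3 : Antitone fun i => ((f i - f (i + 1)) - (f (i + 1) - f (i + 2))) -
      ((f (i + 1) - f (i + 2)) - (f (i + 2) - f (i + 3)))) :
    f 0 / 2 + (f 0 - f 1) / 4 + ((f 0 - f 1) - (f 1 - f 2)) / 8 ≤ ∑' i, (-1) ^ i * f i ∧
      ∑' i, (-1) ^ i * f i ≤
        f 0 / 2 + (f 0 - f 1) / 4 + ((f 0 - f 1) - (f 1 - f 2)) / 4 - ((f 1 - f 2) - (f 2 - f 3)) / 8 := by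
  have hgs : Summable fun i => f i - f (i + 1) := hfs.sub ((summable_nat_add_iff 1).mpr hfs)
  have h := tsum_alternating_bounds_of_convex₂ hgs hc3
  rw [tsum_alternating_sub_succ hfs] at h
  constructor <;> linarith [h.1, h.2]

end Alternating

/-! ## The recurrence of the Laplace moments and the sharp growth bound `γ_m ≤ 4^m/((m+1)(m+2))` -/

/-- **Recurrence of the Laplace moments**: `γ_{m+1} (m+2)² = γ_m (2m+1)(2m+3)` (so `γ_m = (1/2) (1/2)_m (3/2)_m/((2)_m m!)·4^m`,
a hypergeometric term; ratio `→ 4`). [cite: OitmaaHamerZheng2006, §8.2.1 eq. (8.6)] -/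
theorem besselJ01Moment_succ_mul_sq (m : ℕ) :
    besselJ01Moment (m + 1) * ((m : ℝ) + 2) ^ 2 = besselJ01Moment m * ((2 * (m : ℝ) + 1) * (2 * (m : ℝ) + 3)) := by
  have hX : (0 : ℝ) < ((m ! : ℕ) : ℝ) := by positivity
  have hF : (0 : ℝ) < (((2 * m)! : ℕ) : ℝ) := by positivity
  have hm1 : (((m + 1)! : ℕ) : ℝ) = ((m : ℝ) + 1) * ((m ! : ℕ) : ℝ) := by
    rw [Nat.factorial_succ]; push_cast; ring
  have hm2 : (((m + 1 + 1)! : ℕ) : ℝ) = ((m : ℝ) + 2) * (((m : ℝ) + 1) * ((m ! : ℕ) : ℝ)) := by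
    rw [Nat.factorial_succ, Nat.factorial_succ]; push_cast; ring
  have hF1 : (((2 * m + 1)! : ℕ) : ℝ) = (2 * (m : ℝ) + 1) * (((2 * m)! : ℕ) : ℝ) := by
    rw [Nat.factorial_succ]; push_cast; ring
  have hF2 : (((2 * (m + 1))! : ℕ) : ℝ) = (2 * (m : ℝ) + 2) * ((2 * (m : ℝ) + 1) * (((2 * m)! : ℕ) : ℝ)) := by
    rw [show 2 * (m + 1) = (2 * m + 1) + 1 by ring, Nat.factorial_succ, Nat.factorial_succ]; push_cast; ring
  have hF3 : (((2 * (m + 1) + 1)! : ℕ) : ℝ) =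
      (2 * (m : ℝ) + 3) * ((2 * (m : ℝ) + 2) * ((2 * (m : ℝ) + 1) * (((2 * m)! : ℕ) : ℝ))) := by
    rw [show 2 * (m + 1) + 1 = (2 * m + 1) + 1 + 1 by ring, Nat.factorial_succ, Nat.factorial_succ,
      Nat.factorial_succ]; push_cast; ring
  have hC1 : ((((2 * m + 1).choose m) : ℕ) : ℝ) =
      (((2 * m + 1)! : ℕ) : ℝ) / (((m ! : ℕ) : ℝ) * (((m + 1)! : ℕ) : ℝ)) := by
    rw [eq_div_iff (by positivity)]
    have := Nat.choose_mul_factorial_mul_factorial (show m ≤ 2 * m + 1 by omega)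
    rw [show 2 * m + 1 - m = m + 1 by omega] at this
    rw [← mul_assoc]; exact_mod_cast this
  have hC3 : ((((2 * (m + 1) + 1).choose (m + 1)) : ℕ) : ℝ) =
      (((2 * (m + 1) + 1)! : ℕ) : ℝ) / ((((m + 1)! : ℕ) : ℝ) * (((m + 1 + 1)! : ℕ) : ℝ)) := by
    rw [eq_div_iff (by positivity)]
    have := Nat.choose_mul_factorial_mul_factorial (show m + 1 ≤ 2 * (m + 1) + 1 by omega)
    rw [show 2 * (m + 1) + 1 - (m + 1) = m + 1 + 1 by omega] at this
    rw [← mul_assoc]; exact_mod_cast this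
  unfold besselJ01Moment besselJ01Coeff
  rw [hC1, hC3, hF3, hF2, hF1, hm2, hm1]
  field_simp
  ring

/-- The ratio form: `γ_{m+1} = γ_m (2m+1)(2m+3)/(m+2)²`. [cite: OitmaaHamerZheng2006, §8.2.1 eq. (8.6)] -/
theorem besselJ01Moment_succ_eq (m : ℕ) :
    besselJ01Moment (m + 1) = besselJ01Moment m * ((2 * (m : ℝ) + 1) * (2 * (m : ℝ) + 3)) / ((m : ℝ) + 2) ^ 2 := by
  rw [eq_div_iff (by positivity)]
  exact besselJ01Moment_succ_mul_sq m

/-- **Sharp growth of the Laplace moments**: `γ_m (m+1)(m+2) ≤ 4^m` (the quantity `γ_m (m+1)(m+2)/4^m` is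
non-increasing: its ratio is `(2m+1)(2m+3)(m+3)/(4(m+1)(m+2)²) ≤ 1`; true size `γ_m ~ 4^m/(π m²)`). This is what makes
the Laplace series converge absolutely ON the circle `c = 2`. [cite: OitmaaHamerZheng2006, §8.2.1 eq. (8.6)] -/
theorem besselJ01Moment_mul_le_four_pow (m : ℕ) :
    besselJ01Moment m * (((m : ℝ) + 1) * ((m : ℝ) + 2)) ≤ 4 ^ m := by
  induction m with
  | zero => simp
  | succ m ih =>
    have hrec := besselJ01Moment_succ_mul_sq m
    have hpos := besselJ01Moment_pos (m + 1)
    push_cast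
    -- `X (m+1)(m+2)² ≤ 4^{m+1} (m+1)(m+2)²` with `X = γ_{m+1} (m+2)(m+3)`
    have key : besselJ01Moment (m + 1) * (((m : ℝ) + 1 + 1) * ((m : ℝ) + 1 + 2)) *
        (((m : ℝ) + 1) * ((m : ℝ) + 2) ^ 2) ≤ 4 ^ (m + 1) * (((m : ℝ) + 1) * ((m : ℝ) + 2) ^ 2) := by
      have e : besselJ01Moment (m + 1) * (((m : ℝ) + 1 + 1) * ((m : ℝ) + 1 + 2)) *
          (((m : ℝ) + 1) * ((m : ℝ) + 2) ^ 2) =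
          besselJ01Moment m * (((m : ℝ) + 1) * ((m : ℝ) + 2)) *
            ((2 * (m : ℝ) + 1) * (2 * (m : ℝ) + 3) * ((m : ℝ) + 3)) := by
        linear_combination (((m : ℝ) + 1) * ((m : ℝ) + 2) * ((m : ℝ) + 3)) * hrec
      have h3 : besselJ01Moment m * (((m : ℝ) + 1) * ((m : ℝ) + 2)) *
          ((2 * (m : ℝ) + 1) * (2 * (m : ℝ) + 3) * ((m : ℝ) + 3)) ≤
          4 ^ m * ((2 * (m : ℝ) + 1) * (2 * (m : ℝ) + 3) * ((m : ℝ) + 3)) :=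
        mul_le_mul_of_nonneg_right ih (by positivity)
      have h4 : (2 * (m : ℝ) + 1) * (2 * (m : ℝ) + 3) * ((m : ℝ) + 3) ≤ 4 * (((m : ℝ) + 1) * ((m : ℝ) + 2) ^ 2) := by
        nlinarith [Nat.cast_nonneg (α := ℝ) m]
      have h4' : (4 : ℝ) ^ m * ((2 * (m : ℝ) + 1) * (2 * (m : ℝ) + 3) * ((m : ℝ) + 3)) ≤
          4 ^ m * (4 * (((m : ℝ) + 1) * ((m : ℝ) + 2) ^ 2)) := mul_le_mul_of_nonneg_left h4 (by positivity)
      rw [e, pow_succ]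
      linarith
    exact le_of_mul_le_mul_right key (by positivity)

/-- `γ_m ≤ 4^m/((m+1)(m+2))`. [cite: OitmaaHamerZheng2006, §8.2.1 eq. (8.6)] -/
theorem besselJ01Moment_le_four_pow_div (m : ℕ) :
    besselJ01Moment m ≤ 4 ^ m / (((m : ℝ) + 1) * ((m : ℝ) + 2)) := by
  rw [le_div_iff₀ (by positivity)]
  exact besselJ01Moment_mul_le_four_pow m

/-! ## Step 3 ON the circle of convergence: the Laplace transform of `J₀J₁/ω` and of `g` at `c = 2` -/

/-- **Term-by-term Laplace transform at `c = 2`**: `∫₀^∞ e^{-2ω} J₀J₁ dω/ω = Σ_m (-1)^m γ_m/2^{2m+1}`, the series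
now converging like `Σ 1/(2π m²)` (absolutely, by `γ_m/2^{2m+1} ≤ 1/(2(m+1)(m+2))`), so the interchange is still
`Σ_m ∫ |term_m| < ∞`. [cite: OitmaaHamerZheng2006, §8.2.1 eq. (8.5)] -/
theorem hasSum_integral_exp_neg_two_mul_besselJ_zero_mul_one_div :
    HasSum (fun m => (-1) ^ m * besselJ01Moment m / 2 ^ (2 * m + 1))
      (∫ ω in Ioi (0 : ℝ), Real.exp (-(2 * ω)) * (besselJ 0 ω * besselJ 1 ω / ω)) := by
  have hc0 : (0 : ℝ) < 2 := by norm_num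
  set F : ℕ → ℝ → ℝ := fun m ω =>
    Real.exp (-(2 * ω)) * ((-1) ^ m * besselJ01Coeff m / 2 ^ (2 * m + 1) * ω ^ (2 * m)) with hF
  have hFshape : ∀ m, F m = fun ω => ((-1) ^ m * besselJ01Coeff m / 2 ^ (2 * m + 1)) *
      (ω ^ (2 * m) * Real.exp (-(2 * ω))) := by
    intro m; funext ω; simp only [hF]; ring
  have hpow := fun m => integral_pow_mul_exp_neg_mul_Ioi' hc0 (2 * m)
  have hF_int : ∀ m, Integrable (F m) (volume.restrict (Ioi (0 : ℝ))) := by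
    intro m
    rw [hFshape m]
    exact ((hpow m).1).const_mul _
  have hF_val : ∀ m, ∫ ω in Ioi (0 : ℝ), F m ω = (-1) ^ m * besselJ01Moment m / 2 ^ (2 * m + 1) := by
    intro m
    rw [hFshape m, MeasureTheory.integral_const_mul, (hpow m).2, besselJ01Moment]
    field_simp
  have hF_norm : ∀ m, ∫ ω in Ioi (0 : ℝ), ‖F m ω‖ = besselJ01Moment m / 2 ^ (2 * m + 1) := by
    intro m
    have e : (fun ω => ‖F m ω‖) = fun ω => (besselJ01Coeff m / 2 ^ (2 * m + 1)) *
        (ω ^ (2 * m) * Real.exp (-(2 * ω))) := by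
      funext ω
      rw [hFshape m]
      simp only
      rw [Real.norm_eq_abs, abs_mul, abs_mul, abs_div, abs_mul, abs_pow, abs_neg, abs_one, one_pow,
        one_mul, abs_of_pos (besselJ01Coeff_pos m), abs_of_pos (by positivity : (0 : ℝ) < 2 ^ (2 * m + 1)),
        abs_of_nonneg ((even_two_mul m).pow_nonneg ω), Real.abs_exp]
    rw [e, MeasureTheory.integral_const_mul, (hpow m).2, besselJ01Moment]
    field_simp
  -- summability of the norms ON the circle: `γ_m/2^{2m+1} ≤ (1/2)/(m+1)²`
  have hF_sum : Summable fun m => ∫ ω in Ioi (0 : ℝ), ‖F m ω‖ := by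
    simp_rw [hF_norm]
    refine Summable.of_nonneg_of_le (fun m => by have := besselJ01Moment_pos m; positivity)
      (fun m => ?_) ((summable_one_div_succ_pow (le_refl 2)).mul_left (1 / 2))
    have hm : (0 : ℝ) < (m : ℝ) + 1 := by positivity
    have h4 : (4 : ℝ) ^ m = 2 ^ (2 * m) := by rw [pow_mul]; norm_num
    calc besselJ01Moment m / 2 ^ (2 * m + 1) ≤ (4 ^ m / (((m : ℝ) + 1) * ((m : ℝ) + 2))) / 2 ^ (2 * m + 1) := by
          gcongr; exact besselJ01Moment_le_four_pow_div m
      _ ≤ (4 ^ m / (((m : ℝ) + 1) * ((m : ℝ) + 1))) / 2 ^ (2 * m + 1) := by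
          gcongr
          · linarith
      _ = 1 / 2 * (1 / ((m : ℝ) + 1) ^ 2) := by
          rw [h4, pow_succ]
          field_simp
  have hpt : ∀ ω ∈ Ioi (0 : ℝ),
      ∑' m, F m ω = Real.exp (-(2 * ω)) * (besselJ 0 ω * besselJ 1 ω / ω) := by
    intro ω hω
    have h := (hasSum_besselJ_zero_mul_one_div (ne_of_gt hω)).mul_left (Real.exp (-(2 * ω)))
    exact h.tsum_eq
  have hmain := hasSum_integral_of_summable_integral_norm hF_int hF_sum
  rw [setIntegral_congr_fun measurableSet_Ioi hpt] at hmain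
  simp_rw [hF_val] at hmain
  exact hmain

/-- **Step 3 at `c = 2`**: `∫₀^∞ e^{-2ω} g(ω) dω = Σ_{m ≥ 0} (-1)^{m+1} γ_{m+1}/2^{2m+3}` with `g = J₀J₁/ω - 1/2`
(`besselJ01Sub`). [cite: OitmaaHamerZheng2006, §8.2.1 eq. (8.5)] -/
theorem hasSum_integral_exp_neg_two_mul_besselJ01Sub :
    HasSum (fun m : ℕ => (-1) ^ (m + 1) * besselJ01Moment (m + 1) / 2 ^ (2 * m + 3))
      (∫ ω in Ioi (0 : ℝ), Real.exp (-(2 * ω)) * besselJ01Sub ω) := by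
  have hc0 : (0 : ℝ) < 2 := by norm_num
  have h := hasSum_integral_exp_neg_two_mul_besselJ_zero_mul_one_div
  have h1 := (hasSum_nat_add_iff' 1).mpr h
  simp only [Finset.sum_range_one, pow_zero, besselJ01Moment_zero, mul_zero, zero_add, pow_one, one_mul] at h1
  have hhalf : IntegrableOn (fun ω : ℝ => Real.exp (-(2 * ω)) * (1 / 2)) (Ioi 0) :=
    IntegrableOn.congr_fun ((exp_neg_integrableOn_Ioi 0 hc0).mul_const (1 / 2))
      (fun ω _ => by rw [neg_mul]) measurableSet_Ioi
  have hfull : IntegrableOn (fun ω : ℝ => Real.exp (-(2 * ω)) * (besselJ 0 ω * besselJ 1 ω / ω)) (Ioi 0) := by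
    refine IntegrableOn.congr_fun ((integrableOn_exp_neg_mul_besselJ01Sub hc0).add hhalf)
      (fun ω _ => ?_) measurableSet_Ioi
    simp only [Pi.add_apply, besselJ01Sub]
    ring
  have hval : ∫ ω in Ioi (0 : ℝ), Real.exp (-(2 * ω)) * besselJ01Sub ω =
      (∫ ω in Ioi (0 : ℝ), Real.exp (-(2 * ω)) * (besselJ 0 ω * besselJ 1 ω / ω)) - 1 / 2 / 2 := by
    have e : (fun ω : ℝ => Real.exp (-(2 * ω)) * besselJ01Sub ω) =
        fun ω => Real.exp (-(2 * ω)) * (besselJ 0 ω * besselJ 1 ω / ω) - Real.exp (-(2 * ω)) * (1 / 2) := by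
      funext ω; simp only [besselJ01Sub]; ring
    rw [e, integral_sub hfull hhalf, MeasureTheory.integral_mul_const]
    have h0 := integral_pow_mul_exp_neg_mul_Ioi' hc0 0
    simp only [pow_zero, one_mul, Nat.factorial_zero, Nat.cast_one, zero_add, pow_one] at h0
    rw [h0.2]
    ring
  have e : (fun n : ℕ => (-1) ^ (n + 1) * besselJ01Moment (n + 1) / 2 ^ (2 * (n + 1) + 1)) =
      fun m => (-1) ^ (m + 1) * besselJ01Moment (m + 1) / 2 ^ (2 * m + 3) := by
    funext m
    rw [show 2 * (m + 1) + 1 = 2 * m + 3 by ring]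
  rw [e] at h1
  rw [hval]
  exact h1

/-! ## The decomposition at `U = 4`: the boundary Laplace term plus a geometric double series -/

/-- `a_m = γ_{m+1}/2^{2m+3} ≤ 1/4` (crude, from `γ_k ≤ 4^k/2`). [cite: OitmaaHamerZheng2006, §8.2.1 eq. (8.6)] -/
theorem besselJ01Moment_succ_div_le_quarter (m : ℕ) : besselJ01Moment (m + 1) / 2 ^ (2 * m + 3) ≤ 1 / 4 := by
  have h := besselJ01Moment_div_pow_le (by norm_num : (0 : ℝ) < 2) (m + 1)
  rw [show 2 * (m + 1) + 1 = 2 * m + 3 by ring] at h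
  refine h.trans (le_of_eq ?_)
  norm_num

/-- **`e(4)` split at the circle of convergence.** At `U = 4` Step 2 reads
`∫₀^∞ g/(1 + e^{2ω}) = Σ_{n ≥ 0} (-1)^n I_{2(n+1)}`, `I_c = ∫₀^∞ e^{-cω} g`; the `n = 0` term `I₂` sits ON the circle
`c = 2` of Step 3 and is kept as an integral, while for `n ≥ 1` (`c = 2(n+1) ≥ 4`) Step 3 and Fubini give
`Σ_{n ≥ 1} (-1)^n I_{2n+2} = Σ_m (-1)^{m+1} (γ_{m+1}/2^{2m+3}) (η(2m+3) - 1)`. Hence, with `a_m = γ_{m+1}/2^{2m+3}`,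
`liebWuEnergy 4 = -ln 2 - 4 I₂ - 4 Σ_m (-1)^m a_m (1 - η(2m+3))`, the last series converging geometrically
(`0 ≤ 1 - η(2m+3) ≤ 2^{-(2m+3)}`). [cite: OitmaaHamerZheng2006, §8.2.1 eq. (8.5)] -/
theorem liebWuEnergy_four_eq :
    liebWuEnergy 4 = -Real.log 2 - 4 * (∫ ω in Ioi (0 : ℝ), Real.exp (-(2 * ω)) * besselJ01Sub ω) -
      4 * ∑' m : ℕ, (-1) ^ m * (besselJ01Moment (m + 1) / 2 ^ (2 * m + 3)) * (1 - dirichletEta (2 * m + 3)) := by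
  -- Step 1 at `U = 4` and Step 2 with `a = 2`
  have h1 := liebWuEnergy_eq_sub_integral (by norm_num : (0 : ℝ) < 4)
  rw [show (4 : ℝ) / 2 = 2 by norm_num] at h1
  have h2 := hasSum_integral_besselJ01Sub_fermi (by norm_num : (0 : ℝ) < 2)
  have h2' := (hasSum_nat_add_iff' 1).mpr h2
  simp only [Finset.sum_range_one, pow_zero, one_mul, Nat.cast_zero, zero_add] at h2'
  push_cast at h2'
  -- the double family for `n ≥ 1` (re-indexed from `0`)
  obtain ⟨G, hG⟩ : ∃ G : ℕ → ℕ → ℝ, G = fun (n m : ℕ) =>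
      (-1) ^ (n + 1) * ((-1) ^ (m + 1) * besselJ01Moment (m + 1) / (((n : ℝ) + 1 + 1) * 2) ^ (2 * m + 3)) :=
    ⟨_, rfl⟩
  obtain ⟨u, hu⟩ : ∃ u : ℕ → ℝ, u = fun (m : ℕ) => besselJ01Moment (m + 1) / 2 ^ (2 * m + 3) * (1 / 4) ^ m :=
    ⟨_, rfl⟩
  obtain ⟨v, hv⟩ : ∃ v : ℕ → ℝ, v = fun (n : ℕ) => 1 / ((n : ℝ) + 1 + 1) ^ 3 := ⟨_, rfl⟩
  have hu0 : ∀ m, 0 ≤ u m := fun m => by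
    rw [hu]; exact mul_nonneg (div_nonneg (besselJ01Moment_pos _).le (by positivity)) (by positivity)
  have hv0 : ∀ n, 0 ≤ v n := fun n => by rw [hv]; positivity
  have hus : Summable u := by
    rw [hu]
    refine Summable.of_nonneg_of_le
      (fun m => mul_nonneg (div_nonneg (besselJ01Moment_pos _).le (by positivity)) (by positivity))
      (fun m => mul_le_mul_of_nonneg_right (besselJ01Moment_succ_div_le_quarter m) (by positivity)) ?_
    exact (summable_geometric_of_lt_one (by norm_num) (by norm_num : (1 : ℝ) / 4 < 1)).mul_left (1 / 4)
  have hvs : Summable v := by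
    rw [hv]
    have h := (summable_nat_add_iff 1).mpr (summable_one_div_succ_pow (by norm_num : 2 ≤ 3))
    refine h.congr fun n => ?_
    push_cast
    ring
  have hGle : ∀ n m, |G n m| ≤ v n * u m := by
    intro n m
    have hn0 : (0 : ℝ) ≤ (n : ℝ) := Nat.cast_nonneg n
    have habsG : |G n m| =
        besselJ01Moment (m + 1) / (((n : ℝ) + 1 + 1) ^ (2 * m + 3) * 2 ^ (2 * m + 3)) := by
      rw [hG]
      simp only
      rw [abs_mul, abs_pow, abs_neg, abs_one, one_pow, one_mul, abs_div, abs_mul, abs_pow, abs_neg, abs_one,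
        one_pow, one_mul, abs_of_pos (besselJ01Moment_pos _),
        abs_of_pos (by positivity : (0 : ℝ) < (((n : ℝ) + 1 + 1) * 2) ^ (2 * m + 3)), mul_pow]
    have h4m : (4 : ℝ) ^ m ≤ ((n : ℝ) + 1 + 1) ^ (2 * m) := by
      rw [pow_mul]
      exact pow_le_pow_left₀ (by norm_num) (by nlinarith) m
    have hγ := (besselJ01Moment_pos (m + 1)).le
    rw [habsG, hu, hv]
    simp only
    rw [show ((n : ℝ) + 1 + 1) ^ (2 * m + 3) = ((n : ℝ) + 1 + 1) ^ 3 * ((n : ℝ) + 1 + 1) ^ (2 * m) by ring,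
      div_le_iff₀ (by positivity)]
    have e : 1 / ((n : ℝ) + 1 + 1) ^ 3 * (besselJ01Moment (m + 1) / 2 ^ (2 * m + 3) * (1 / 4) ^ m) *
        (((n : ℝ) + 1 + 1) ^ 3 * ((n : ℝ) + 1 + 1) ^ (2 * m) * 2 ^ (2 * m + 3)) =
        besselJ01Moment (m + 1) * (((n : ℝ) + 1 + 1) ^ (2 * m) / 4 ^ m) := by
      field_simp
      rw [mul_assoc, ← mul_pow]
      norm_num
    rw [e]
    have h1' : (1 : ℝ) ≤ ((n : ℝ) + 1 + 1) ^ (2 * m) / 4 ^ m := by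
      rw [le_div_iff₀ (by positivity), one_mul]; exact h4m
    calc besselJ01Moment (m + 1) = besselJ01Moment (m + 1) * 1 := (mul_one _).symm
      _ ≤ besselJ01Moment (m + 1) * (((n : ℝ) + 1 + 1) ^ (2 * m) / 4 ^ m) := by gcongr
  have hGs : Summable (Function.uncurry G) := by
    refine Summable.of_norm_bounded (hvs.mul_of_nonneg hus hv0 hu0) fun nm => ?_
    rw [Real.norm_eq_abs]
    exact hGle nm.1 nm.2
  -- rows: Step 3 off the circle (`c = 2(n+2) ≥ 4`)
  have hrow : ∀ n : ℕ, HasSum (fun m => G n m)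
      ((-1) ^ (n + 1) * ∫ ω in Ioi (0 : ℝ), Real.exp (-(((n : ℝ) + 1 + 1) * 2 * ω)) * besselJ01Sub ω) := by
    intro n
    have hc : (2 : ℝ) < ((n : ℝ) + 1 + 1) * 2 := by have : (0 : ℝ) ≤ n := Nat.cast_nonneg n; nlinarith
    have h := (hasSum_integral_exp_neg_mul_besselJ01Sub hc).mul_left ((-1 : ℝ) ^ (n + 1))
    rw [hG]
    exact h
  -- columns: the shifted eta series
  have hcol : ∀ m : ℕ, HasSum (fun n => G n m)
      ((-1) ^ m * (besselJ01Moment (m + 1) / 2 ^ (2 * m + 3)) * (1 - dirichletEta (2 * m + 3))) := by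
    intro m
    have hη := (hasSum_nat_add_iff' 1).mpr (hasSum_dirichletEta (by omega : 2 ≤ 2 * m + 3))
    simp only [Finset.sum_range_one, pow_zero, Nat.cast_zero, zero_add, one_pow, div_one] at hη
    have hη' := hη.mul_left ((-1) ^ (m + 1) * (besselJ01Moment (m + 1) / 2 ^ (2 * m + 3)))
    have e2 : (fun n => G n m) = fun n : ℕ =>
        (-1) ^ (m + 1) * (besselJ01Moment (m + 1) / 2 ^ (2 * m + 3)) *
          ((-1) ^ (n + 1) / (((n + 1 : ℕ) : ℝ) + 1) ^ (2 * m + 3)) := by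
      funext n
      rw [hG]
      simp only
      push_cast
      have hn : (0 : ℝ) < (n : ℝ) + 1 + 1 := by positivity
      rw [mul_pow]
      field_simp
    have e3 : (-1 : ℝ) ^ m * (besselJ01Moment (m + 1) / 2 ^ (2 * m + 3)) * (1 - dirichletEta (2 * m + 3)) =
        (-1) ^ (m + 1) * (besselJ01Moment (m + 1) / 2 ^ (2 * m + 3)) * (dirichletEta (2 * m + 3) - 1) := by
      rw [pow_succ]
      ring
    rw [e2, e3]
    exact hη'
  -- Fubini
  have hswap : ∑' m, ∑' n, G n m = ∑' n, ∑' m, G n m :=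
    hGs.tsum_comm' (fun n => (hrow n).summable) (fun m => (hcol m).summable)
  have hT : ∑' m, (-1) ^ m * (besselJ01Moment (m + 1) / 2 ^ (2 * m + 3)) * (1 - dirichletEta (2 * m + 3)) =
      ∑' m, ∑' n, G n m := tsum_congr fun m => ((hcol m).tsum_eq).symm
  have hR : ∑' n, ∑' m, G n m = (∫ ω in Ioi (0 : ℝ), besselJ01Sub ω * (1 / (1 + Real.exp (2 * ω)))) -
      ∫ ω in Ioi (0 : ℝ), Real.exp (-(2 * ω)) * besselJ01Sub ω := by
    rw [← h2'.tsum_eq]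
    exact tsum_congr fun n => (hrow n).tsum_eq
  rw [h1, hT, hswap, hR]
  ring

/-! ## The boundary sequence `a_m = γ_{m+1}/2^{2m+3}` (shifted by `N`): ratio, monotonicity of its first three
differences, summability

The sequence is written `j ↦ γ_{j+N+1}/2^{2j+2N+3}` with an arbitrary shift `N` so that the tail after `N` terms is
literally the `N`-shifted sequence. Its ratio is `r(x) = (2x+3)(2x+5)/(4(x+3)²)`, `x = j + N`; the numerators
`1 - r`, `1 - 2r(x) + r(x)r(x+1)`, `1 - 3r(x) + 3r(x)r(x+1) - r(x)r(x+1)r(x+2)` over the common denominators are the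
polynomials `8x + 21`, `96x² + 600x + 909`, `1536x³ + 16704x² + 58800x + 66825` with non-negative coefficients
(indeed `a_m = (3/64)(3/2)_m(5/2)_m/((3)_m)²` is a product of two Hausdorff moment sequences, hence completely monotone). -/

/-- Ratio of consecutive boundary terms: `a_{x+1} = a_x (2x+3)(2x+5)/(4(x+3)²)`, `x = j + N`.
[cite: OitmaaHamerZheng2006, §8.2.1 eq. (8.6)] -/
theorem boundaryTerm_succ (N j : ℕ) :
    besselJ01Moment (j + 1 + N + 1) / 2 ^ (2 * (j + 1) + 2 * N + 3) =
      besselJ01Moment (j + N + 1) / 2 ^ (2 * j + 2 * N + 3) *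
        ((2 * ((j : ℝ) + N) + 3) * (2 * ((j : ℝ) + N) + 5) / (4 * ((j : ℝ) + N + 3) ^ 2)) := by
  have h := besselJ01Moment_succ_eq (j + N + 1)
  rw [show j + 1 + N + 1 = j + N + 1 + 1 by ring, h]
  push_cast
  rw [show 2 * (j + 1) + 2 * N + 3 = (2 * j + 2 * N + 3) + 2 by ring, pow_add]
  have h3 : (0 : ℝ) < (j : ℝ) + N + 1 + 2 := by positivity
  field_simp
  ring

/-- Positivity of the boundary terms. [cite: OitmaaHamerZheng2006, §8.2.1 eq. (8.6)] -/
theorem boundaryTerm_pos (N j : ℕ) : 0 < besselJ01Moment (j + N + 1) / 2 ^ (2 * j + 2 * N + 3) := by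
  have := besselJ01Moment_pos (j + N + 1)
  positivity

/-- The boundary terms decrease (`r ≤ 1`: `4(x+3)² - (2x+3)(2x+5) = 8x + 21`).
[cite: OitmaaHamerZheng2006, §8.2.1 eq. (8.6)] -/
theorem antitone_boundaryTerm (N : ℕ) :
    Antitone fun j : ℕ => besselJ01Moment (j + N + 1) / 2 ^ (2 * j + 2 * N + 3) := by
  refine antitone_nat_of_succ_le fun j => ?_
  rw [boundaryTerm_succ N j]
  refine mul_le_of_le_one_right (boundaryTerm_pos N j).le ?_
  rw [div_le_one (by positivity)]
  nlinarith [Nat.cast_nonneg (α := ℝ) j, Nat.cast_nonneg (α := ℝ) N]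

/-- The first differences of the boundary terms decrease (convexity; numerator `96x² + 600x + 909`).
[cite: OitmaaHamerZheng2006, §8.2.1 eq. (8.6)] -/
theorem antitone_boundaryTerm_sub (N : ℕ) :
    Antitone fun j : ℕ => besselJ01Moment (j + N + 1) / 2 ^ (2 * j + 2 * N + 3) -
      besselJ01Moment (j + 1 + N + 1) / 2 ^ (2 * (j + 1) + 2 * N + 3) := by
  refine antitone_nat_of_succ_le fun j => ?_
  have h1 := boundaryTerm_succ N j
  have h2 := boundaryTerm_succ N (j + 1)
  push_cast at h2
  rw [h2, h1]
  set A := besselJ01Moment (j + N + 1) / 2 ^ (2 * j + 2 * N + 3) with hA_def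
  have hA : 0 < A := boundaryTerm_pos N j
  set x : ℝ := (j : ℝ) + N with hx
  have hx0 : 0 ≤ x := by rw [hx]; positivity
  have e1 : (2 * ((j : ℝ) + 1 + N) + 3) * (2 * ((j : ℝ) + 1 + N) + 5) / (4 * ((j : ℝ) + 1 + N + 3) ^ 2) =
      (2 * x + 5) * (2 * x + 7) / (4 * (x + 4) ^ 2) := by rw [hx]; ring_nf
  rw [e1]
  have key : 1 - 2 * ((2 * x + 3) * (2 * x + 5) / (4 * (x + 3) ^ 2)) +
      (2 * x + 3) * (2 * x + 5) / (4 * (x + 3) ^ 2) * ((2 * x + 5) * (2 * x + 7) / (4 * (x + 4) ^ 2)) =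
      (96 * x ^ 2 + 600 * x + 909) / (16 * (x + 3) ^ 2 * (x + 4) ^ 2) := by
    field_simp
    ring
  have hq : 0 ≤ 1 - 2 * ((2 * x + 3) * (2 * x + 5) / (4 * (x + 3) ^ 2)) +
      (2 * x + 3) * (2 * x + 5) / (4 * (x + 3) ^ 2) * ((2 * x + 5) * (2 * x + 7) / (4 * (x + 4) ^ 2)) := by
    rw [key]; positivity
  set r0 := (2 * x + 3) * (2 * x + 5) / (4 * (x + 3) ^ 2)
  set r1 := (2 * x + 5) * (2 * x + 7) / (4 * (x + 4) ^ 2)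
  calc A * r0 - A * r0 * r1 = (A - A * r0) - A * (1 - 2 * r0 + r0 * r1) := by ring
    _ ≤ A - A * r0 := sub_le_self _ (mul_nonneg hA.le hq)

/-- The second differences of the boundary terms decrease (numerator `1536x³ + 16704x² + 58800x + 66825`).
[cite: OitmaaHamerZheng2006, §8.2.1 eq. (8.6)] -/
theorem antitone_boundaryTerm_sub₂ (N : ℕ) :
    Antitone fun j : ℕ =>
      (besselJ01Moment (j + N + 1) / 2 ^ (2 * j + 2 * N + 3) -
        besselJ01Moment (j + 1 + N + 1) / 2 ^ (2 * (j + 1) + 2 * N + 3)) -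
      (besselJ01Moment (j + 1 + N + 1) / 2 ^ (2 * (j + 1) + 2 * N + 3) -
        besselJ01Moment (j + 1 + 1 + N + 1) / 2 ^ (2 * (j + 1 + 1) + 2 * N + 3)) := by
  refine antitone_nat_of_succ_le fun j => ?_
  have h1 := boundaryTerm_succ N j
  have h2 := boundaryTerm_succ N (j + 1)
  have h3 := boundaryTerm_succ N (j + 1 + 1)
  push_cast at h2 h3
  rw [h3, h2, h1]
  set A := besselJ01Moment (j + N + 1) / 2 ^ (2 * j + 2 * N + 3) with hA_def
  have hA : 0 < A := boundaryTerm_pos N j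
  set x : ℝ := (j : ℝ) + N with hx
  have hx0 : 0 ≤ x := by rw [hx]; positivity
  have e1 : (2 * ((j : ℝ) + 1 + N) + 3) * (2 * ((j : ℝ) + 1 + N) + 5) / (4 * ((j : ℝ) + 1 + N + 3) ^ 2) =
      (2 * x + 5) * (2 * x + 7) / (4 * (x + 4) ^ 2) := by rw [hx]; ring_nf
  have e2 : (2 * ((j : ℝ) + 1 + 1 + N) + 3) * (2 * ((j : ℝ) + 1 + 1 + N) + 5) /
      (4 * ((j : ℝ) + 1 + 1 + N + 3) ^ 2) = (2 * x + 7) * (2 * x + 9) / (4 * (x + 5) ^ 2) := by rw [hx]; ring_nf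
  rw [e1, e2]
  set r0 := (2 * x + 3) * (2 * x + 5) / (4 * (x + 3) ^ 2) with hr0
  set r1 := (2 * x + 5) * (2 * x + 7) / (4 * (x + 4) ^ 2) with hr1
  set r2 := (2 * x + 7) * (2 * x + 9) / (4 * (x + 5) ^ 2) with hr2
  have key : 1 - 3 * r0 + 3 * (r0 * r1) - r0 * r1 * r2 =
      (1536 * x ^ 3 + 16704 * x ^ 2 + 58800 * x + 66825) / (64 * (x + 3) ^ 2 * (x + 4) ^ 2 * (x + 5) ^ 2) := by
    rw [hr0, hr1, hr2]
    field_simp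
    ring
  have hq : 0 ≤ 1 - 3 * r0 + 3 * (r0 * r1) - r0 * r1 * r2 := by rw [key]; positivity
  calc A * r0 - A * r0 * r1 - (A * r0 * r1 - A * r0 * r1 * r2)
      = (A - A * r0 - (A * r0 - A * r0 * r1)) - A * (1 - 3 * r0 + 3 * (r0 * r1) - r0 * r1 * r2) := by ring
    _ ≤ A - A * r0 - (A * r0 - A * r0 * r1) := sub_le_self _ (mul_nonneg hA.le hq)

/-- The third differences of the boundary terms decrease (numerator
`30720x⁴ + 506880x³ + 3050880x² + 7920720x + 7464825`). [cite: OitmaaHamerZheng2006, §8.2.1 eq. (8.6)] -/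
theorem antitone_boundaryTerm_sub₃ (N : ℕ) :
    Antitone fun j : ℕ =>
      ((besselJ01Moment (j + N + 1) / 2 ^ (2 * j + 2 * N + 3) -
          besselJ01Moment (j + 1 + N + 1) / 2 ^ (2 * (j + 1) + 2 * N + 3)) -
        (besselJ01Moment (j + 1 + N + 1) / 2 ^ (2 * (j + 1) + 2 * N + 3) -
          besselJ01Moment (j + 1 + 1 + N + 1) / 2 ^ (2 * (j + 1 + 1) + 2 * N + 3))) -
      ((besselJ01Moment (j + 1 + N + 1) / 2 ^ (2 * (j + 1) + 2 * N + 3) -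
          besselJ01Moment (j + 1 + 1 + N + 1) / 2 ^ (2 * (j + 1 + 1) + 2 * N + 3)) -
        (besselJ01Moment (j + 1 + 1 + N + 1) / 2 ^ (2 * (j + 1 + 1) + 2 * N + 3) -
          besselJ01Moment (j + 1 + 1 + 1 + N + 1) / 2 ^ (2 * (j + 1 + 1 + 1) + 2 * N + 3))) := by
  refine antitone_nat_of_succ_le fun j => ?_
  have h1 := boundaryTerm_succ N j
  have h2 := boundaryTerm_succ N (j + 1)
  have h3 := boundaryTerm_succ N (j + 1 + 1)
  have h4 := boundaryTerm_succ N (j + 1 + 1 + 1)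
  push_cast at h2 h3 h4
  rw [h4, h3, h2, h1]
  set A := besselJ01Moment (j + N + 1) / 2 ^ (2 * j + 2 * N + 3) with hA_def
  have hA : 0 < A := boundaryTerm_pos N j
  set x : ℝ := (j : ℝ) + N with hx
  have hx0 : 0 ≤ x := by rw [hx]; positivity
  have e1 : (2 * ((j : ℝ) + 1 + N) + 3) * (2 * ((j : ℝ) + 1 + N) + 5) / (4 * ((j : ℝ) + 1 + N + 3) ^ 2) =
      (2 * x + 5) * (2 * x + 7) / (4 * (x + 4) ^ 2) := by rw [hx]; ring_nf
  have e2 : (2 * ((j : ℝ) + 1 + 1 + N) + 3) * (2 * ((j : ℝ) + 1 + 1 + N) + 5) /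
      (4 * ((j : ℝ) + 1 + 1 + N + 3) ^ 2) = (2 * x + 7) * (2 * x + 9) / (4 * (x + 5) ^ 2) := by rw [hx]; ring_nf
  have e3 : (2 * ((j : ℝ) + 1 + 1 + 1 + N) + 3) * (2 * ((j : ℝ) + 1 + 1 + 1 + N) + 5) /
      (4 * ((j : ℝ) + 1 + 1 + 1 + N + 3) ^ 2) = (2 * x + 9) * (2 * x + 11) / (4 * (x + 6) ^ 2) := by
    rw [hx]; ring_nf
  rw [e1, e2, e3]
  set r0 := (2 * x + 3) * (2 * x + 5) / (4 * (x + 3) ^ 2) with hr0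
  set r1 := (2 * x + 5) * (2 * x + 7) / (4 * (x + 4) ^ 2) with hr1
  set r2 := (2 * x + 7) * (2 * x + 9) / (4 * (x + 5) ^ 2) with hr2
  set r3 := (2 * x + 9) * (2 * x + 11) / (4 * (x + 6) ^ 2) with hr3
  have key : 1 - 4 * r0 + 6 * (r0 * r1) - 4 * (r0 * r1 * r2) + r0 * r1 * r2 * r3 =
      (30720 * x ^ 4 + 506880 * x ^ 3 + 3050880 * x ^ 2 + 7920720 * x + 7464825) /
        (256 * (x + 3) ^ 2 * (x + 4) ^ 2 * (x + 5) ^ 2 * (x + 6) ^ 2) := by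
    rw [hr0, hr1, hr2, hr3]
    field_simp
    ring
  have hq : 0 ≤ 1 - 4 * r0 + 6 * (r0 * r1) - 4 * (r0 * r1 * r2) + r0 * r1 * r2 * r3 := by rw [key]; positivity
  calc A * r0 - A * r0 * r1 - (A * r0 * r1 - A * r0 * r1 * r2) -
        (A * r0 * r1 - A * r0 * r1 * r2 - (A * r0 * r1 * r2 - A * r0 * r1 * r2 * r3))
      = (A - A * r0 - (A * r0 - A * r0 * r1) - (A * r0 - A * r0 * r1 - (A * r0 * r1 - A * r0 * r1 * r2))) -
          A * (1 - 4 * r0 + 6 * (r0 * r1) - 4 * (r0 * r1 * r2) + r0 * r1 * r2 * r3) := by ring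
    _ ≤ A - A * r0 - (A * r0 - A * r0 * r1) - (A * r0 - A * r0 * r1 - (A * r0 * r1 - A * r0 * r1 * r2)) :=
        sub_le_self _ (mul_nonneg hA.le hq)

/-- Summability of the boundary terms: `a_x ≤ 1/(2(x+2)(x+3)) ≤ (1/2)/(j+1)²`.
[cite: OitmaaHamerZheng2006, §8.2.1 eq. (8.6)] -/
theorem summable_boundaryTerm (N : ℕ) :
    Summable fun j : ℕ => besselJ01Moment (j + N + 1) / 2 ^ (2 * j + 2 * N + 3) := by
  refine Summable.of_nonneg_of_le (fun j => (boundaryTerm_pos N j).le) (fun j => ?_)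
    ((summable_one_div_succ_pow (le_refl 2)).mul_left (1 / 2))
  have hγ := besselJ01Moment_le_four_pow_div (j + N + 1)
  push_cast at hγ
  have hN : (0 : ℝ) ≤ N := Nat.cast_nonneg N
  have h4 : (4 : ℝ) ^ (j + N + 1) = 2 ^ (2 * j + 2 * N + 2) := by
    rw [show (4 : ℝ) = 2 ^ 2 by norm_num, ← pow_mul]
    ring_nf
  calc besselJ01Moment (j + N + 1) / 2 ^ (2 * j + 2 * N + 3)
      ≤ (4 ^ (j + N + 1) / (((j : ℝ) + N + 1 + 1) * ((j : ℝ) + N + 1 + 2))) / 2 ^ (2 * j + 2 * N + 3) := by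
        gcongr
    _ = 1 / (2 * (((j : ℝ) + N + 2) * ((j : ℝ) + N + 3))) := by
        rw [h4, pow_succ]
        field_simp
        ring
    _ ≤ 1 / (2 * ((j : ℝ) + 1) ^ 2) := by
        apply one_div_le_one_div_of_le (by positivity)
        nlinarith
    _ = 1 / 2 * (1 / ((j : ℝ) + 1) ^ 2) := by rw [one_div_mul_one_div]

/-! ## Enclosure of the boundary integral `I₂ = ∫₀^∞ e^{-2ω} g(ω) dω` -/

/-- **`I₂ ∈ [-0.033993278044, -0.033993274926]`** (width `3.1·10⁻⁹`; true value `-0.0339932765750…`): `40` terms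
of `Σ (-1)^{m+1} γ_{m+1}/2^{2m+3}` (the tree's `γ_1, …, γ_40`) and the fourth-order convexity enclosure of the
alternating tail `T = Σ_j (-1)^j a_{40+j} ∈ [a/2 + Δa/4 + Δ²a/8, a/2 + Δa/4 + Δ²a/4 - Δ²a'/8]` at `m = 40`
(`γ_41, …, γ_44`). [cite: OitmaaHamerZheng2006, §8.2.1 eq. (8.5)] -/
theorem integral_exp_neg_two_mul_besselJ01Sub_mem_Icc :
    (∫ ω in Ioi (0 : ℝ), Real.exp (-(2 * ω)) * besselJ01Sub ω) ∈
      Icc (-0.033993278044 : ℝ) (-0.033993274926) := by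
  have h := hasSum_integral_exp_neg_two_mul_besselJ01Sub
  have hs := h.summable
  have hsplit := hs.sum_add_tsum_nat_add 40
  rw [h.tsum_eq] at hsplit
  -- the tail is minus the alternating series of the 40-shifted boundary terms
  have htail : ∑' i : ℕ, (fun m : ℕ => (-1 : ℝ) ^ (m + 1) * besselJ01Moment (m + 1) / 2 ^ (2 * m + 3)) (i + 40) =
      -∑' i : ℕ, (-1 : ℝ) ^ i * (besselJ01Moment (i + 40 + 1) / 2 ^ (2 * i + 2 * 40 + 3)) := by
    rw [← tsum_neg]
    refine tsum_congr fun i => ?_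
    simp only
    rw [show 2 * (i + 40) + 3 = 2 * i + 2 * 40 + 3 by ring, pow_succ]
    ring
  have hb := tsum_alternating_bounds_of_convex₃ (summable_boundaryTerm 40) (antitone_boundaryTerm_sub₃ 40)
  have hsum : ∑ i ∈ range 40, (fun m : ℕ => (-1 : ℝ) ^ (m + 1) * besselJ01Moment (m + 1) / 2 ^ (2 * m + 3)) i =
      -12403329159776712695757837602627094382468516403 / 365375409332725729550921208179070754913983135744 := by
    simp only [Finset.sum_range_succ, Finset.sum_range_zero]
    norm_num [besselJ01Moment_one, besselJ01Moment_two, besselJ01Moment_three, besselJ01Moment_four,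
      besselJ01Moment_five, besselJ01Moment_six, besselJ01Moment_seven, besselJ01Moment_eight, besselJ01Moment_nine,
      besselJ01Moment_ten, besselJ01Moment_eleven, besselJ01Moment_twelve, besselJ01Moment_13, besselJ01Moment_14,
      besselJ01Moment_15, besselJ01Moment_16, besselJ01Moment_17, besselJ01Moment_18, besselJ01Moment_19,
      besselJ01Moment_20, besselJ01Moment_21, besselJ01Moment_22, besselJ01Moment_23, besselJ01Moment_24,
      besselJ01Moment_25, besselJ01Moment_26, besselJ01Moment_27, besselJ01Moment_28, besselJ01Moment_29,
      besselJ01Moment_30, besselJ01Moment_31, besselJ01Moment_32, besselJ01Moment_33, besselJ01Moment_34,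
      besselJ01Moment_35, besselJ01Moment_36, besselJ01Moment_37, besselJ01Moment_38, besselJ01Moment_39,
      besselJ01Moment_40]
  have f0 : besselJ01Moment (0 + 40 + 1) / 2 ^ (2 * 0 + 2 * 40 + 3) =
      (530636374381070885289400150022823401509557075 / 604462909807314587353088 : ℝ) / 2 ^ 83 := by
    norm_num [besselJ01Moment_41]
  have f1 : besselJ01Moment (1 + 40 + 1) / 2 ^ (2 * 1 + 2 * 40 + 3) =
      (2024683407927774524454687971017316980881517125 / 604462909807314587353088 : ℝ) / 2 ^ 85 := by
    norm_num [besselJ01Moment_42]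
  have f2 : besselJ01Moment (2 + 40 + 1) / 2 ^ (2 * 2 + 2 * 40 + 3) =
      (123739948773767707506962128476636851848089414375 / 9671406556917033397649408 : ℝ) / 2 ^ 87 := by
    norm_num [besselJ01Moment_43]
  have f3 : besselJ01Moment (3 + 40 + 1) / 2 ^ (2 * 3 + 2 * 40 + 3) =
      (473144900422362152704398894219555132770250042225 / 9671406556917033397649408 : ℝ) / 2 ^ 89 := by
    norm_num [besselJ01Moment_44]
  rw [f0, f1, f2, f3] at hb
  rw [htail, hsum] at hsplit
  rw [Set.mem_Icc, ← hsplit]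
  norm_num at hb ⊢
  constructor <;> linarith [hb.1, hb.2]

/-! ## A tighter `η(3)` (second-order convexity enclosure of the 100-term remainder) -/

/-- **`η(3) ∈ [0.9015426701635, 0.9015426842975]`** (width `1.4·10⁻⁸`, vs `1.9·10⁻⁶` for the tree's
`dirichletEta_3_bounds` from the same `100` terms; `η(3) = (3/4)ζ(3) = 0.90154267736969…`): the alternating remainder
`Σ_{j ≥ 0} (-1)^j/(j+101)³` lies in `[b₀/2, b₀ - b₁/2]`, `b_j = 1/(j+101)³`, by convexity of `b`. [cite: DLMF, 25.2.3] -/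
theorem dirichletEta_three_mem_Icc : dirichletEta 3 ∈ Icc (0.9015426701635 : ℝ) 0.9015426842975 := by
  have h := hasSum_dirichletEta (by norm_num : 2 ≤ 3)
  have hs := h.summable
  have hsplit := hs.sum_add_tsum_nat_add 100
  rw [h.tsum_eq] at hsplit
  have htail : ∑' i : ℕ, (fun n : ℕ => (-1 : ℝ) ^ n / ((n : ℝ) + 1) ^ 3) (i + 100) =
      ∑' i : ℕ, (-1 : ℝ) ^ i * (1 / ((i : ℝ) + 100 + 1) ^ 3) := by
    refine tsum_congr fun i => ?_
    simp only
    push_cast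
    rw [pow_add, show ((-1 : ℝ)) ^ 100 = 1 by norm_num]
    ring
  have hbs : Summable fun i : ℕ => 1 / ((i : ℝ) + 100 + 1) ^ 3 := by
    have := (summable_nat_add_iff 100).mpr (summable_one_div_succ_pow (by norm_num : 2 ≤ 3))
    refine this.congr fun i => ?_
    push_cast
    rfl
  have hconv : Antitone fun i : ℕ =>
      1 / ((i : ℝ) + 100 + 1) ^ 3 - 1 / (((i + 1 : ℕ) : ℝ) + 100 + 1) ^ 3 := by
    refine antitone_nat_of_succ_le fun i => ?_
    push_cast
    set y : ℝ := (i : ℝ) + 100 + 1 with hy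
    have hy0 : 0 < y := by rw [hy]; positivity
    have e1 : (i : ℝ) + 1 + 100 + 1 = y + 1 := by rw [hy]; ring
    have e2 : (i : ℝ) + 1 + 1 + 100 + 1 = y + 2 := by rw [hy]; ring
    rw [e1, e2]
    have key : (1 / y ^ 3 - 1 / (y + 1) ^ 3) - (1 / (y + 1) ^ 3 - 1 / (y + 2) ^ 3) =
        (12 * y ^ 4 + 48 * y ^ 3 + 66 * y ^ 2 + 36 * y + 8) / (y ^ 3 * (y + 1) ^ 3 * (y + 2) ^ 3) := by
      field_simp
      ring
    have : 0 ≤ (1 / y ^ 3 - 1 / (y + 1) ^ 3) - (1 / (y + 1) ^ 3 - 1 / (y + 2) ^ 3) := by rw [key]; positivity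
    linarith
  have hb := tsum_alternating_bounds_of_convex hbs hconv
  rw [htail] at hsplit
  rw [Set.mem_Icc, ← hsplit]
  norm_num [Finset.sum_range_succ] at hb ⊢
  constructor <;> linarith [hb.1, hb.2]

/-! ## Enclosure of the geometric part `R = Σ_m (-1)^m a_m (1 - η(2m+3))` -/

/-- `|(-1)^m a_m (1 - η(2m+3))| ≤ (1/4)/2^{2m+3}`. [cite: OitmaaHamerZheng2006, §8.2.1 eq. (8.5)] -/
theorem abs_boundaryTail_term_le (m : ℕ) :
    |(-1 : ℝ) ^ m * (besselJ01Moment (m + 1) / 2 ^ (2 * m + 3)) * (1 - dirichletEta (2 * m + 3))| ≤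
      1 / 4 * (1 / 2 ^ (2 * m + 3)) := by
  have hη := dirichletEta_mem_Icc (by omega : 2 ≤ 2 * m + 3)
  rw [Set.mem_Icc] at hη
  have ha := besselJ01Moment_succ_div_le_quarter m
  have ha0 : 0 ≤ besselJ01Moment (m + 1) / 2 ^ (2 * m + 3) := div_nonneg (besselJ01Moment_pos _).le (by positivity)
  rw [abs_mul, abs_mul, abs_pow, abs_neg, abs_one, one_pow, one_mul, abs_of_nonneg ha0,
    abs_of_nonneg (by linarith [hη.2])]
  exact mul_le_mul ha (by linarith [hη.1]) (by linarith [hη.2]) (by norm_num)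

/-- Summability of the geometric part. [cite: OitmaaHamerZheng2006, §8.2.1 eq. (8.5)] -/
theorem summable_boundaryTail :
    Summable fun m : ℕ =>
      (-1 : ℝ) ^ m * (besselJ01Moment (m + 1) / 2 ^ (2 * m + 3)) * (1 - dirichletEta (2 * m + 3)) := by
  have hg : Summable fun m : ℕ => (1 : ℝ) / 4 * (1 / 2 ^ (2 * m + 3)) := by
    have h := (summable_geometric_of_lt_one (by norm_num) (by norm_num : (1 : ℝ) / 4 < 1)).mul_left (1 / 32)
    refine h.congr fun m => ?_
    rw [pow_add, pow_mul, one_div_pow]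
    norm_num
    ring
  refine Summable.of_norm_bounded hg fun m => ?_
  rw [Real.norm_eq_abs]
  exact abs_boundaryTail_term_le m

/-- **`R ∈ [0.00413881211, 0.00413883231]`** (width `2·10⁻⁸`; true value `0.00413882340964…`): twelve terms with the
`η`-enclosures (`η(3)` above, `η(5), …, η(25)` of `LiebWuEnergyHalfFillingEnclosure`) and the geometric tail
`Σ_{m ≥ 12} ≤ (1/4) 2^{-27}/(1 - 1/4) = 1/(3·2^27)`. [cite: OitmaaHamerZheng2006, §8.2.1 eq. (8.5)] -/
theorem tsum_boundaryTail_mem_Icc :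
    (∑' m : ℕ, (-1 : ℝ) ^ m * (besselJ01Moment (m + 1) / 2 ^ (2 * m + 3)) * (1 - dirichletEta (2 * m + 3))) ∈
      Icc (0.00413881211 : ℝ) 0.00413883231 := by
  set T : ℕ → ℝ := fun m =>
    (-1 : ℝ) ^ m * (besselJ01Moment (m + 1) / 2 ^ (2 * m + 3)) * (1 - dirichletEta (2 * m + 3)) with hT
  have hs : Summable T := summable_boundaryTail
  have hsplit := hs.sum_add_tsum_nat_add 12
  -- the geometric tail
  have htail_s : Summable fun m => |T (m + 12)| := ((summable_nat_add_iff 12).mpr hs).abs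
  have hgeo : HasSum (fun m : ℕ => (1 : ℝ) / 2 ^ 29 * (1 / 4) ^ m) (1 / 2 ^ 29 * (1 - 1 / 4)⁻¹) :=
    (hasSum_geometric_of_lt_one (by norm_num) (by norm_num)).mul_left _
  have htail : |∑' m, T (m + 12)| ≤ 1 / 2 ^ 29 * (1 - 1 / 4)⁻¹ := by
    have hn := norm_tsum_le_tsum_norm (f := fun m => T (m + 12)) (by simpa only [Real.norm_eq_abs] using htail_s)
    simp only [Real.norm_eq_abs] at hn
    refine hn.trans ?_
    rw [← hgeo.tsum_eq]
    refine htail_s.tsum_le_tsum (fun m => ?_) hgeo.summable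
    refine (abs_boundaryTail_term_le (m + 12)).trans (le_of_eq ?_)
    have e : (1 : ℝ) / 2 ^ (2 * (m + 12) + 3) = 1 / 2 ^ 27 * (1 / 4) ^ m := by
      rw [show 2 * (m + 12) + 3 = 2 * m + 27 by ring, pow_add, pow_mul, one_div_pow, one_div_mul_one_div, mul_comm]
      norm_num
    rw [e]
    ring
  rw [abs_le] at htail
  -- the twelve head terms
  obtain ⟨a0, b0⟩ := dirichletEta_three_mem_Icc
  obtain ⟨a1, b1⟩ := dirichletEta_5_bounds
  obtain ⟨a2, b2⟩ := dirichletEta_7_bounds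
  obtain ⟨a3, b3⟩ := dirichletEta_9_bounds
  obtain ⟨a4, b4⟩ := dirichletEta_11_bounds
  obtain ⟨a5, b5⟩ := dirichletEta_13_bounds
  obtain ⟨a6, b6⟩ := dirichletEta_15_bounds
  obtain ⟨a7, b7⟩ := dirichletEta_17_bounds
  obtain ⟨a8, b8⟩ := dirichletEta_19_bounds
  obtain ⟨a9, b9⟩ := dirichletEta_21_bounds
  obtain ⟨a10, b10⟩ := dirichletEta_23_bounds
  obtain ⟨a11, b11⟩ := dirichletEta_25_bounds
  rw [Set.mem_Icc, ← hsplit]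
  simp only [hT, Finset.sum_range_succ, Finset.sum_range_zero]
  norm_num [besselJ01Moment_one, besselJ01Moment_two, besselJ01Moment_three, besselJ01Moment_four,
    besselJ01Moment_five, besselJ01Moment_six, besselJ01Moment_seven, besselJ01Moment_eight, besselJ01Moment_nine,
    besselJ01Moment_ten, besselJ01Moment_eleven, besselJ01Moment_twelve] at a0 b0 htail ⊢
  constructor
  · nlinarith [htail.1, htail.2, a0, b0, a1, b1, a2, b2, a3, b3, a4, b4, a5, b5, a6, b6, a7, b7, a8, b8, a9, b9,
      a10, b10, a11, b11]
  · nlinarith [htail.1, htail.2, a0, b0, a1, b1, a2, b2, a3, b3, a4, b4, a5, b5, a6, b6, a7, b7, a8, b8, a9, b9,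
      a10, b10, a11, b11]

/-! ## The enclosure of `e_LW(4)` -/

/-- **`e_LW(U = 4) = liebWuEnergy 4 ∈ [-0.573729411, -0.573729316]`** (width `9.5·10⁻⁸`; the cell's 30-digit value
is `-0.57372936789844927…`, REFVALS `M1/TL/n1/U4/e0/LiebWu-CERT`). The point `U = 4t` is ON the circle of
convergence `u = U/4t = 1` of Takahashi's large-`u` series (8.5)–(8.7), where the series itself is useless for an
enclosure (it converges like `Σ 1/m²`); the proof instead isolates the single boundary Laplace term `I₂`
(`liebWuEnergy_four_eq`) and encloses it by convexity of its alternating series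
(`integral_exp_neg_two_mul_besselJ01Sub_mem_Icc`), `ln 2` by Mathlib's `log_two_near_10`, `R` by
`tsum_boundaryTail_mem_Icc`. [cite: LiebWuPRL1968, eq. (20)] -/
theorem liebWuEnergy_four_mem_Icc : liebWuEnergy 4 ∈ Set.Icc (-0.573729411) (-0.573729316) := by
  rw [liebWuEnergy_four_eq]
  have hI := integral_exp_neg_two_mul_besselJ01Sub_mem_Icc
  have hR := tsum_boundaryTail_mem_Icc
  rw [Set.mem_Icc] at hI hR
  have l := Real.log_two_near_10
  rw [abs_le] at l
  norm_num at l
  rw [Set.mem_Icc]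
  constructor
  · linarith [hI.2, hR.2, l.2]
  · linarith [hI.1, hR.1, l.1]

/-- The same as a distance to a round midpoint: `|liebWuEnergy 4 + 0.57372936| ≤ 6·10⁻⁸`.
[cite: LiebWuPRL1968, eq. (20)] -/
theorem abs_liebWuEnergy_four_add_le : |liebWuEnergy 4 + 0.57372936| ≤ 0.00000006 := by
  have h := liebWuEnergy_four_mem_Icc
  rw [Set.mem_Icc] at h
  rw [abs_le]
  constructor <;> linarith [h.1, h.2]

end Literature.Analysis.FunctionSpaces
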